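import Literature.MathematicalPhysics.KineticTheory.HierarchyDuhamelSeries
import HarnessLib

/-!
# Null-set robustness of the Duhamel terms restricted to families supported in a domain
(Bodineau–Gallagher–Saint-Raymond 2016 §3.1 Remark 3.1 and §4.3–4.4, pp. 9, 13; trunk T-KINETIC,
topic MathematicalPhysics/KineticTheory; a CORRECTION layer on top of `HierarchyDuhamelSeries`
(N5e) of the bottom-up plan towards fact (c) `bodineau_gallagher_saintRaymond_linear`.)

`HierarchyDuhamelSeries` introduced the hypothesis `HierarchyModel.RespectsAE M μ` — nice
families equal `μ_k`-a.e. at every level have `μ_s`-a.e. equal Duhamel terms — under which the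
a priori bound of the marginals is transferred to the finite Duhamel series. For the hard-sphere
model of `HardSphereHierarchyModel` with the Lebesgue measures this hypothesis, quantified over
ALL nice families, is FALSE: the collision operator also reads its argument at adjoined
configurations OUTSIDE the hard-sphere domain (a sphere adjoined in contact with sphere `i` may
overlap a third sphere, for a set of impact vectors of positive measure), the regularised flow is
the identity there, and these reads cover a Lebesgue-null set of `(s+1)`-configurations on which
two nice families may differ. The physical families (marginals of densities supported in the
domain, their Duhamel series) all VANISH outside the domain, and for such families the robustness
is exactly the non-singularity of the pseudo-trajectories (reads inside the domain happen at
outgoing contact configurations, good for flux-almost every parameter by the flux form of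
Alexander's theorem, `HardSphereOutgoingGood`, and transported backwards over an integrated time).

This file therefore introduces the restricted hypothesis and re-threads the two results of
`HierarchyDuhamelSeries` that consume it:

* `HierarchyModel.PreservesSupport M D` — Duhamel terms of families vanishing off the sets `D k`
  vanish off `D s`;
* `HierarchyModel.RespectsAEOn M μ D` — `RespectsAE` restricted to nice families vanishing off
  `D` (implied by `RespectsAE`, `RespectsAE.respectsAEOn`);
* `blockOp_congr_ae_on`, `tailOp_congr_ae_on`, `blockComp_congr_ae_on` and the support lemmas
  `blockOp_eq_zero_of_not_mem`, `tailOp_eq_zero_of_not_mem`, `blockComp_eq_zero_of_not_mem`;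
* `seriesFamily_ae_eq_blockComp_add_on`, `seriesFamily_ae_abs_sub_blockComp_le_on` — BGSR
  (4.8)–(4.9) and Prop. 4.3 for the series family up to null sets, under `RespectsAEOn`, for data
  and comparison families vanishing off `D`.

## References

* T. Bodineau, I. Gallagher, L. Saint-Raymond, Invent. Math. 203 (2016), arXiv:1305.3397v2,
  §3.1 Remark 3.1 p. 9; §4.3–4.4 (4.8)–(4.9), Prop. 4.3 (4.14), p. 13.
-/

open MeasureTheory Metric Real Set Filter Function
open scoped Nat
open Literature.Analysis.FluidPDE (Config configEnergy GCState duhamelTerm duhamelTerm_zero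
  duhamelTerm_succ)

namespace Literature.MathematicalPhysics.KineticTheory

noncomputable section

section Kinetic

variable {d : Type*} [Fintype d] {X : Type*} [MeasurableSpace X]

namespace HierarchyModel

variable (M : HierarchyModel d X)

/-! ## Support preservation and the restricted robustness hypothesis -/

/-- The Duhamel terms of `M` *preserve vanishing off the sets `D k`*: if a family vanishes off
`D k` at every level `k`, so do all its Duhamel terms `Q_{s,s+n}(h)` off `D s` (for hard spheres:
`D k` the hard-sphere domain, `duhamelTerm_hsHierarchyModel_eq_zero_of_not_mem`). [folklore] -/
def PreservesSupport (D : (s : ℕ) → Set (Config s d X)) : Prop :=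
  ∀ (n s : ℕ) (h : ℝ) (G : GCState d X), (∀ (k : ℕ) (Z : Config k d X), Z ∉ D k → G k Z = 0) →
    ∀ Z : Config s d X, Z ∉ D s → duhamelTerm M.transport M.op n s h G Z = 0

/-- The Duhamel terms of `M` *respect `μ`-null sets on families supported in `D`*: nice families
which vanish off the sets `D k` and agree `μ_k`-almost everywhere at every level have
`μ_s`-a.e. equal Duhamel terms. This is the form in which the non-singularity of the
pseudo-trajectories of the hard-sphere hierarchy (BGSR Remark 3.1; Simonella 2014) is true; the
unrestricted `RespectsAE` fails for it because of reads outside the domain (module docstring).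
[cite: BodineauGallagherSaintRaymondInvent2016, §3.1 Remark 3.1, p. 9] -/
def RespectsAEOn (μ : (s : ℕ) → Measure (Config s d X)) (D : (s : ℕ) → Set (Config s d X)) : Prop :=
  ∀ (n s : ℕ) {h : ℝ}, 0 ≤ h → ∀ {G₁ G₂ : GCState d X}, (∀ k, IsNice (G₁ k)) → (∀ k, IsNice (G₂ k)) →
    (∀ (k : ℕ) (Z : Config k d X), Z ∉ D k → G₁ k Z = 0) → (∀ (k : ℕ) (Z : Config k d X), Z ∉ D k → G₂ k Z = 0) →
    (∀ k, G₁ k =ᵐ[μ k] G₂ k) →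
      duhamelTerm M.transport M.op n s h G₁ =ᵐ[μ s] duhamelTerm M.transport M.op n s h G₂

variable {M}

/-- The unrestricted hypothesis implies the restricted one. [folklore] -/
theorem RespectsAE.respectsAEOn {μ : (s : ℕ) → Measure (Config s d X)} (hR : M.RespectsAE μ)
    (D : (s : ℕ) → Set (Config s d X)) : M.RespectsAEOn μ D :=
  fun n s _ hh _ _ h₁ h₂ _ _ hae => hR n s hh h₁ h₂ hae

section Support

variable {D : (s : ℕ) → Set (Config s d X)} (hD : M.PreservesSupport D)

include hD

/-- Blocks of families supported in `D` are supported in `D`. [folklore] -/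
theorem blockOp_eq_zero_of_not_mem (n : ℕ) (h : ℝ) {G : GCState d X}
    (hG : ∀ (k : ℕ) (Z : Config k d X), Z ∉ D k → G k Z = 0) (a : ℕ) (Z : Config a d X) (hZ : Z ∉ D a) :
    M.blockOp n h G a Z = 0 := by
  rw [blockOp_apply]
  exact Finset.sum_eq_zero fun j _ => hD j a h G hG Z hZ

/-- Tails of families supported in `D` are supported in `D`. [folklore] -/
theorem tailOp_eq_zero_of_not_mem (n Nmax : ℕ) (h : ℝ) {G : GCState d X}
    (hG : ∀ (k : ℕ) (Z : Config k d X), Z ∉ D k → G k Z = 0) (a : ℕ) (Z : Config a d X) (hZ : Z ∉ D a) :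
    M.tailOp n Nmax h G a Z = 0 := by
  rw [tailOp_apply]
  exact Finset.sum_eq_zero fun j _ => hD j a h G hG Z hZ

/-- Composites of blocks of families supported in `D` are supported in `D`. [folklore] -/
theorem blockComp_eq_zero_of_not_mem (nseq : ℕ → ℕ) (h : ℝ) (k : ℕ) :
    ∀ {G : GCState d X}, (∀ (a : ℕ) (Z : Config a d X), Z ∉ D a → G a Z = 0) →
      ∀ (a : ℕ) (Z : Config a d X), Z ∉ D a → M.blockComp nseq h k G a Z = 0 := by
  induction k with
  | zero => intro G hG a Z hZ; simpa using hG a Z hZ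
  | succ k ih =>
    intro G hG a Z hZ
    rw [blockComp_succ]
    exact ih (fun a Z hZ => blockOp_eq_zero_of_not_mem hD (nseq k) h hG a Z hZ) a Z hZ

end Support

section AE

variable {μ : (s : ℕ) → Measure (Config s d X)} {D : (s : ℕ) → Set (Config s d X)}

/-- Blocks respect null sets on families supported in `D`. [folklore] -/
theorem blockOp_congr_ae_on (hR : M.RespectsAEOn μ D) (n : ℕ) {h : ℝ} (hh : 0 ≤ h) {G₁ G₂ : GCState d X}
    (h₁ : ∀ k, IsNice (G₁ k)) (h₂ : ∀ k, IsNice (G₂ k))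
    (s₁ : ∀ (k : ℕ) (Z : Config k d X), Z ∉ D k → G₁ k Z = 0) (s₂ : ∀ (k : ℕ) (Z : Config k d X), Z ∉ D k → G₂ k Z = 0)
    (hae : ∀ k, G₁ k =ᵐ[μ k] G₂ k) (a : ℕ) :
    M.blockOp n h G₁ a =ᵐ[μ a] M.blockOp n h G₂ a := by
  have hall : ∀ᵐ Z ∂(μ a), ∀ j ∈ Finset.range n,
      duhamelTerm M.transport M.op j a h G₁ Z = duhamelTerm M.transport M.op j a h G₂ Z :=
    (Filter.eventually_all_finset _).2 fun j _ => hR j a hh h₁ h₂ s₁ s₂ hae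
  filter_upwards [hall] with Z hZ
  simp only [blockOp_apply]
  exact Finset.sum_congr rfl hZ

/-- Tails respect null sets on families supported in `D`. [folklore] -/
theorem tailOp_congr_ae_on (hR : M.RespectsAEOn μ D) (n Nmax : ℕ) {h : ℝ} (hh : 0 ≤ h) {G₁ G₂ : GCState d X}
    (h₁ : ∀ k, IsNice (G₁ k)) (h₂ : ∀ k, IsNice (G₂ k))
    (s₁ : ∀ (k : ℕ) (Z : Config k d X), Z ∉ D k → G₁ k Z = 0) (s₂ : ∀ (k : ℕ) (Z : Config k d X), Z ∉ D k → G₂ k Z = 0)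
    (hae : ∀ k, G₁ k =ᵐ[μ k] G₂ k) (a : ℕ) :
    M.tailOp n Nmax h G₁ a =ᵐ[μ a] M.tailOp n Nmax h G₂ a := by
  have hall : ∀ᵐ Z ∂(μ a), ∀ j ∈ Finset.Ico n (Nmax + 1),
      duhamelTerm M.transport M.op j a h G₁ Z = duhamelTerm M.transport M.op j a h G₂ Z :=
    (Filter.eventually_all_finset _).2 fun j _ => hR j a hh h₁ h₂ s₁ s₂ hae
  filter_upwards [hall] with Z hZ
  simp only [tailOp_apply]
  exact Finset.sum_congr rfl hZ

/-- Composites of blocks respect null sets on families supported in `D` (the model preserving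
supports). [folklore] -/
theorem blockComp_congr_ae_on (hR : M.RespectsAEOn μ D) (hD : M.PreservesSupport D) (nseq : ℕ → ℕ) {h : ℝ}
    (hh : 0 ≤ h) (k : ℕ) :
    ∀ {G₁ G₂ : GCState d X}, (∀ a, IsNice (G₁ a)) → (∀ a, IsNice (G₂ a)) →
      (∀ (a : ℕ) (Z : Config a d X), Z ∉ D a → G₁ a Z = 0) → (∀ (a : ℕ) (Z : Config a d X), Z ∉ D a → G₂ a Z = 0) →
      (∀ a, G₁ a =ᵐ[μ a] G₂ a) → ∀ a, M.blockComp nseq h k G₁ a =ᵐ[μ a] M.blockComp nseq h k G₂ a := by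
  induction k with
  | zero => intro G₁ G₂ _ _ _ _ hae a; simpa using hae a
  | succ k ih =>
    intro G₁ G₂ h₁ h₂ s₁ s₂ hae a
    simp only [blockComp_succ]
    exact ih (fun a => isNice_blockOp h₁ (nseq k) hh a) (fun a => isNice_blockOp h₂ (nseq k) hh a)
      (fun a Z hZ => blockOp_eq_zero_of_not_mem hD (nseq k) h s₁ a Z hZ)
      (fun a Z hZ => blockOp_eq_zero_of_not_mem hD (nseq k) h s₂ a Z hZ)
      (fun a => blockOp_congr_ae_on hR (nseq k) hh h₁ h₂ s₁ s₂ hae a) a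

/-- **The pruned expansion up to null sets (BGSR (4.8)–(4.9)), for families supported in `D`.**
`seriesFamily_ae_eq_blockComp_add` with `RespectsAEOn` in place of `RespectsAE`, for a nice
datum `f₀` vanishing above `Nmax` and off `D`, a model preserving supports, and comparison
families `P(t_i)` vanishing off `D`. [cite: BodineauGallagherSaintRaymondInvent2016, §4.3 (4.8)-(4.9), p. 13] -/
theorem seriesFamily_ae_eq_blockComp_add_on
    (hflow : ∀ (s : ℕ) (a b : ℝ) (Z : Config s d X), M.flow s (a + b) Z = M.flow s a (M.flow s b Z))
    {Nmax : ℕ} {f₀ : GCState d X} (hf₀ : ∀ k, IsNice (f₀ k)) (hvan : ∀ k, Nmax < k → f₀ k = 0)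
    (hf₀D : ∀ (k : ℕ) (Z : Config k d X), Z ∉ D k → f₀ k Z = 0)
    (hR : M.RespectsAEOn μ D) (hD : M.PreservesSupport D) (nseq : ℕ → ℕ) {h : ℝ} (hh : 0 ≤ h) (K : ℕ)
    {P : (s : ℕ) → ℝ → Config s d X → ℝ} (hP : ∀ i < K, ∀ k, IsNice (P k (K * h - (i + 1) * h)))
    (hPD : ∀ i < K, ∀ (k : ℕ) (Z : Config k d X), Z ∉ D k → P k (K * h - (i + 1) * h) Z = 0)
    (hS : ∀ i < K, ∀ k,
      M.seriesFamily Nmax f₀ k (K * h - (i + 1) * h) =ᵐ[μ k] P k (K * h - (i + 1) * h)) :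
    M.seriesFamily Nmax f₀ 1 (K * h) =ᵐ[μ 1] fun Z =>
      M.blockComp nseq h K (fun a => M.seriesFamily Nmax f₀ a 0) 1 Z +
        ∑ i ∈ Finset.range K, M.blockComp nseq h i
          (M.tailOp (nseq i) Nmax h (fun k => P k (K * h - (i + 1) * h))) 1 Z := by
  set F := M.seriesFamily Nmax f₀ with hFdef
  have hF : M.IsMildSolution (K * h) F := isMildSolution_seriesFamily hflow hf₀ hvan (K * h)
  -- the series family is supported in `D`
  have hFD : ∀ (t : ℝ) (k : ℕ) (Z : Config k d X), Z ∉ D k → F k t Z = 0 := by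
    intro t k Z hZ
    rw [hFdef, seriesFamily]
    exact Finset.sum_eq_zero fun n _ => hD n k t f₀ hf₀D Z hZ
  -- block times are nonnegative
  have hti : ∀ i < K, 0 ≤ K * h - (i + 1) * h := by
    intro i hi
    have : (i + 1 : ℝ) ≤ K := by exact_mod_cast hi
    nlinarith
  -- the remainders are tails, everywhere
  have hrem : ∀ i < K, (fun a Z => M.iterRem F (K * h - (i + 1) * h) (nseq i) a h Z) =
      M.tailOp (nseq i) Nmax h (fun k => F k (K * h - (i + 1) * h)) := by
    intro i hi
    funext a Z
    exact iterRem_seriesFamily hflow hf₀ hvan (hti i hi) (nseq i) a hh Z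
  -- exchange `F(t_i)` for `P(t_i)` inside the tails, block by block
  have hall : ∀ᵐ Z ∂(μ 1), ∀ i ∈ Finset.range K,
      M.blockComp nseq h i (M.tailOp (nseq i) Nmax h (fun k => F k (K * h - (i + 1) * h))) 1 Z =
        M.blockComp nseq h i (M.tailOp (nseq i) Nmax h (fun k => P k (K * h - (i + 1) * h))) 1 Z := by
    refine (Filter.eventually_all_finset _).2 fun i hi => ?_
    have hi' : i < K := Finset.mem_range.1 hi
    have hFn : ∀ k, IsNice (F k (K * h - (i + 1) * h)) := fun k => isNice_seriesFamily hf₀ Nmax k (hti i hi')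
    exact blockComp_congr_ae_on hR hD nseq hh i (fun a => isNice_tailOp hFn (nseq i) Nmax hh a)
      (fun a => isNice_tailOp (hP i hi') (nseq i) Nmax hh a)
      (fun a Z hZ => tailOp_eq_zero_of_not_mem hD (nseq i) Nmax h (hFD _) a Z hZ)
      (fun a Z hZ => tailOp_eq_zero_of_not_mem hD (nseq i) Nmax h (hPD i hi') a Z hZ)
      (fun a => tailOp_congr_ae_on hR (nseq i) Nmax hh hFn (hP i hi') (hFD _) (hPD i hi') (hS i hi') a) 1
  filter_upwards [hall] with Z hZ
  have hspec := hF.blockComp_spec nseq hh le_rfl K (by simp) 1 Z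
  simp only [sub_self] at hspec
  rw [hspec]
  congr 1
  refine Finset.sum_congr rfl fun i hi => ?_
  rw [hrem i (Finset.mem_range.1 hi)]
  exact hZ i hi

/-- **BGSR Proposition 4.3 for the finite Duhamel series, almost everywhere, for families
supported in `D`.** `seriesFamily_ae_abs_sub_blockComp_le` with `RespectsAEOn` in place of
`RespectsAE`: the datum `f₀` and the comparison family `P` vanish off `D` and the model
preserves supports. [cite: BodineauGallagherSaintRaymondInvent2016, §4.4 Prop. 4.3 (4.14), p. 13] -/
theorem seriesFamily_ae_abs_sub_blockComp_le_on
    (hflow : ∀ (s : ℕ) (a b : ℝ) (Z : Config s d X), M.flow s (a + b) Z = M.flow s a (M.flow s b Z))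
    {Nmax : ℕ} {f₀ : GCState d X} (hf₀ : ∀ k, IsNice (f₀ k)) (hvan : ∀ k, Nmax < k → f₀ k = 0)
    (hf₀D : ∀ (k : ℕ) (Z : Config k d X), Z ∉ D k → f₀ k Z = 0)
    (hR : M.RespectsAEOn μ D) (hD : M.PreservesSupport D) {T : ℝ} {P : (s : ℕ) → ℝ → Config s d X → ℝ}
    (hPm : ∀ (k : ℕ), ∀ τ ∈ Icc 0 T, Measurable (P k τ))
    (hPD : ∀ (k : ℕ), ∀ τ ∈ Icc 0 T, ∀ Z : Config k d X, Z ∉ D k → P k τ Z = 0)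
    {R₀ C₀ β : ℝ} (hR₀ : 0 ≤ R₀) (hC₀ : 1 ≤ C₀) (hβ : 0 < β)
    (hPb : ∀ (k : ℕ), ∀ τ ∈ Icc 0 T, ∀ Z : Config k d X,
      |P k τ Z| ≤ R₀ * C₀ ^ k * exp (-β * configEnergy Z))
    {A : ℕ} (hA : 2 ≤ A) {γ : ℝ} (hγ0 : 0 ≤ γ) (hγ : γ ≤ 1 / 2) {h : ℝ} (hh0 : 0 ≤ h)
    (hsmall : C₀ * M.pruneConst β * h ≤ γ / exp 2) (K : ℕ) (hKT : K * h ≤ T)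
    (hS : ∀ i < K, ∀ k,
      M.seriesFamily Nmax f₀ k (K * h - (i + 1) * h) =ᵐ[μ k] P k (K * h - (i + 1) * h)) :
    ∀ᵐ Z ∂(μ 1), |M.seriesFamily Nmax f₀ 1 (K * h) Z -
        M.blockComp (pruneSeq A) h K (fun a => M.seriesFamily Nmax f₀ a 0) 1 Z| ≤ 4 * γ ^ A * R₀ * C₀ := by
  -- block times lie in `[0, T]`
  have hti : ∀ i < K, K * h - (i + 1) * h ∈ Icc 0 T := by
    intro i hi
    have : (i + 1 : ℝ) ≤ K := by exact_mod_cast hi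
    refine ⟨by nlinarith, ?_⟩
    nlinarith [mul_nonneg (by positivity : (0 : ℝ) ≤ i + 1) hh0]
  have hP : ∀ i < K, ∀ k, IsNice (P k (K * h - (i + 1) * h)) := fun i hi k =>
    ⟨hPm k _ (hti i hi), R₀ * C₀ ^ k, β, hβ, hPb k _ (hti i hi)⟩
  have hae := seriesFamily_ae_eq_blockComp_add_on hflow hf₀ hvan hf₀D hR hD (pruneSeq A) hh0 K hP
    (fun i hi k Z hZ => hPD k _ (hti i hi) Z hZ) hS
  filter_upwards [hae] with Z hZ
  rw [hZ, add_sub_cancel_left]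
  exact abs_tailRemainder_le (M := M) (P := fun i k => P k (K * h - (i + 1) * h)) hR₀ hC₀ hβ K
    (fun i hi k Z' => hPb k _ (hti i hi) Z') hA hγ0 hγ hh0 hsmall Nmax Z

end AE

end HierarchyModel

end Kinetic

end

end Literature.MathematicalPhysics.KineticTheory
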